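import Mathlib
import Summits.Langlands.Langlands.Theorems.CapacityClassicalityHilbertIntegralOverconvergentIsCongruenceStubMvKatzNormMul
import Summits.Langlands.Langlands.Theorems.CapacityClassicalityHilbertIntegralOverconvergentIsCongruenceStubMvKatzSumMul
import Summits.Langlands.Langlands.Theorems.CapacityClassicalityHilbertIntegralOverconvergentIsCongruenceStubMvCoeffMulBound
import Summits.Langlands.Langlands.Theorems.CapacityClassicalityHilbertIntegralOverconvergentIsCongruenceStubMvCoeffInvBound

/-!
# Crux `HilbertIntegralOverconvergentIsCongruence` (stmt-Langlands-8485), line `Sketch-ideate-r1-k1`: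
# stub `stub_katzDataPolynomial` — the `d`-free algebra of Katz data

Over a nonarchimedean normed field `K`, fix a graded family `V : ℤ → Set (MvPowerSeries σ K)` of
`K`-subspaces closed under products (`V b₁ · V b₂ ⊆ V (b₁ + b₂)`, `1 ∈ V 0`), an integral series `e`
with constant term `1` ("Hasse lift" of weight `t`), and a Katz datum `(a_i)` of weight `w`
(`a_i ∈ V (w + i t)`, `‖a_i‖ ≤ C ρ^i` coefficientwise, `0 ≤ ρ ≤ 1 ≤ C`) with Katz sum
`G = Σ_i a_i e^{-i}` (coefficientwise `HasSum`).  For finitely many `u` with exponents `j_u ≤ D`,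
integral series `f_u ∈ V (T - j_u w)` and scalars `‖λ_u‖ ≤ 1`, the polynomial expression
`F = Σ_u λ_u f_u G^{j_u}` is again a Katz sum, of pure weight `T`: there is a datum `A_i ∈ V (T + i t)`
with `‖A_i‖ ≤ C^D ρ^i` summing to `F` along `e⁻¹`, and `‖F_n‖ ≤ C^D` for every exponent `n`.

Proof: package the datum as its generating series `Φ = Σ_i a_i X^i ∈ (MvPowerSeries σ K)⟦X⟧`; the
membership, norm and sum conditions are stable under the Cauchy product (`katzPoly_memFamily_mul`,
`stub_mvKatzNormMul`, `stub_mvKatzSumMul`), hence under powers (`katzPoly_memFamily_pow`,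
`katzPoly_normFamily_pow`, `katzPoly_sumFamily_pow`), under multiplication by the constants `f_u`,
by the scalars `λ_u`, and under finite sums (ultrametric inequality); the final bound is the
ultrametric `tsum` inequality with `‖e^{-i}‖ ≤ 1` (`stub_mvCoeffInvBound`,
`katzPoly_normCoeff_pow_le_one`).  Theorems only.
-/

set_option linter.dupNamespace false

noncomputable section

namespace Summit.Langlands.Langlands.Theorems.HilbertIntegralOverconvergentIsCongruence

/-- Membership families of Katz data are stable under the Cauchy product: if
`coeff_i Φ₁ ∈ V (b₁ + i t)` and `coeff_i Φ₂ ∈ V (b₂ + i t)` for all `i`, where the graded family `V`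
contains `0`, is closed under addition and satisfies `V b₁ · V b₂ ⊆ V (b₁ + b₂)`, then
`coeff_i (Φ₁ Φ₂) ∈ V (b₁ + b₂ + i t)` for all `i`. -/
theorem katzPoly_memFamily_mul {K σ : Type*} [Semiring K]
    (V : ℤ → Set (MvPowerSeries σ K)) (hV0 : ∀ b : ℤ, (0 : MvPowerSeries σ K) ∈ V b)
    (hVadd : ∀ (b : ℤ) (φ ψ : MvPowerSeries σ K), φ ∈ V b → ψ ∈ V b → φ + ψ ∈ V b)
    (hVmul : ∀ (b₁ b₂ : ℤ) (φ ψ : MvPowerSeries σ K), φ ∈ V b₁ → ψ ∈ V b₂ → φ * ψ ∈ V (b₁ + b₂))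
    (t b₁ b₂ : ℤ) (Φ₁ Φ₂ : PowerSeries (MvPowerSeries σ K))
    (h₁ : ∀ i : ℕ, PowerSeries.coeff i Φ₁ ∈ V (b₁ + i * t))
    (h₂ : ∀ i : ℕ, PowerSeries.coeff i Φ₂ ∈ V (b₂ + i * t)) :
    ∀ i : ℕ, PowerSeries.coeff i (Φ₁ * Φ₂) ∈ V (b₁ + b₂ + i * t) := by
  intro i
  rw [PowerSeries.coeff_mul]
  refine Finset.sum_induction _ (fun φ ↦ φ ∈ V (b₁ + b₂ + i * t))
    (fun φ ψ hφ hψ ↦ hVadd _ φ ψ hφ hψ) (hV0 _) fun p hp ↦ ?_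
  rw [Finset.HasAntidiagonal.mem_antidiagonal] at hp
  have hidx : b₁ + b₂ + (i : ℤ) * t = (b₁ + p.1 * t) + (b₂ + p.2 * t) := by
    rw [← hp]
    push_cast
    ring
  rw [hidx]
  exact hVmul _ _ _ _ (h₁ p.1) (h₂ p.2)

/-- Membership families of Katz data are stable under powers: if `coeff_i Φ ∈ V (w + i t)` for all
`i` (with `V` as in `katzPoly_memFamily_mul` and `1 ∈ V 0`), then `coeff_i (Φ ^ m) ∈ V (m w + i t)`
for all `m, i`. -/
theorem katzPoly_memFamily_pow {K σ : Type*} [Semiring K]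
    (V : ℤ → Set (MvPowerSeries σ K)) (hV1 : (1 : MvPowerSeries σ K) ∈ V 0)
    (hV0 : ∀ b : ℤ, (0 : MvPowerSeries σ K) ∈ V b)
    (hVadd : ∀ (b : ℤ) (φ ψ : MvPowerSeries σ K), φ ∈ V b → ψ ∈ V b → φ + ψ ∈ V b)
    (hVmul : ∀ (b₁ b₂ : ℤ) (φ ψ : MvPowerSeries σ K), φ ∈ V b₁ → ψ ∈ V b₂ → φ * ψ ∈ V (b₁ + b₂))
    (t w : ℤ) (Φ : PowerSeries (MvPowerSeries σ K))
    (h : ∀ i : ℕ, PowerSeries.coeff i Φ ∈ V (w + i * t)) :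
    ∀ m i : ℕ, PowerSeries.coeff i (Φ ^ m) ∈ V (m * w + i * t) := by
  intro m
  induction m with
  | zero =>
    intro i
    rw [pow_zero, PowerSeries.coeff_one]
    split_ifs with hi
    · subst hi
      simpa using hV1
    · exact hV0 _
  | succ m ih =>
    intro i
    have hidx : ((m + 1 : ℕ) : ℤ) * w + i * t = m * w + w + i * t := by
      push_cast
      ring
    rw [pow_succ, hidx]
    exact katzPoly_memFamily_mul V hV0 hVadd hVmul t (m * w) w (Φ ^ m) Φ ih h i

/-- Norm families of Katz data are stable under powers: over a nonarchimedean normed field, if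
`‖(coeff_i Φ)_n‖ ≤ C ρ^i` for all `i, n` (`ρ, C ≥ 0`), then `‖(coeff_i (Φ ^ m))_n‖ ≤ C^m ρ^i`. -/
theorem katzPoly_normFamily_pow {K σ : Type*} [NormedField K] [IsUltrametricDist K]
    (ρ C : ℝ) (hρ : 0 ≤ ρ) (hC : 0 ≤ C) (Φ : PowerSeries (MvPowerSeries σ K))
    (h : ∀ i n, ‖MvPowerSeries.coeff n (PowerSeries.coeff i Φ)‖ ≤ C * ρ ^ i) :
    ∀ (m i : ℕ) n, ‖MvPowerSeries.coeff n (PowerSeries.coeff i (Φ ^ m))‖ ≤ C ^ m * ρ ^ i := by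
  classical
  intro m
  induction m with
  | zero =>
    intro i n
    rw [pow_zero, pow_zero, one_mul, PowerSeries.coeff_one]
    split_ifs with hi
    · subst hi
      rw [pow_zero, MvPowerSeries.coeff_one]
      split_ifs <;> simp
    · rw [map_zero, norm_zero]
      exact pow_nonneg hρ i
  | succ m ih =>
    intro i n
    rw [pow_succ, pow_succ]
    exact stub_mvKatzNormMul ρ (C ^ m) C hρ (pow_nonneg hC m) hC (Φ ^ m) Φ ih h i n

/-- Sum families of Katz data are stable under powers: over a nonarchimedean normed field, if
`Σ_i (coeff_i Φ · Q^i)_n = G_n` as a `HasSum` for every exponent `n`, then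
`Σ_i (coeff_i (Φ ^ m) · Q^i)_n = (G ^ m)_n` for every `m, n`. -/
theorem katzPoly_sumFamily_pow {K σ : Type*} [NormedField K] [IsUltrametricDist K]
    (Q : MvPowerSeries σ K) (Φ : PowerSeries (MvPowerSeries σ K)) (G : MvPowerSeries σ K)
    (h : ∀ n, HasSum (fun i : ℕ ↦ MvPowerSeries.coeff n (PowerSeries.coeff i Φ * Q ^ i))
      (MvPowerSeries.coeff n G)) :
    ∀ (m : ℕ) n, HasSum (fun i : ℕ ↦ MvPowerSeries.coeff n (PowerSeries.coeff i (Φ ^ m) * Q ^ i))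
      (MvPowerSeries.coeff n (G ^ m)) := by
  intro m
  induction m with
  | zero =>
    intro n
    rw [pow_zero, pow_zero]
    refine (hasSum_ite_eq 0 _).congr_fun fun i ↦ ?_
    rw [PowerSeries.coeff_one]
    split_ifs with hi
    · rw [hi, pow_zero, mul_one]
    · rw [zero_mul, map_zero]
  | succ m ih =>
    intro n
    rw [pow_succ, pow_succ]
    exact stub_mvKatzSumMul Q (Φ ^ m) Φ (G ^ m) G ih h n

/-- Powers of a coefficientwise integral multivariable power series over a nonarchimedean normed
field are coefficientwise integral: `‖ψ_n‖ ≤ 1` for all `n` implies `‖(ψ ^ k)_n‖ ≤ 1`. -/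
theorem katzPoly_normCoeff_pow_le_one {K σ : Type*} [NormedField K] [IsUltrametricDist K]
    (ψ : MvPowerSeries σ K) (hψ : ∀ n, ‖MvPowerSeries.coeff n ψ‖ ≤ 1) :
    ∀ (k : ℕ) n, ‖MvPowerSeries.coeff n (ψ ^ k)‖ ≤ 1 := by
  classical
  intro k
  induction k with
  | zero =>
    intro n
    rw [pow_zero, MvPowerSeries.coeff_one]
    split_ifs <;> simp
  | succ k ih =>
    intro n
    rw [pow_succ]
    simpa only [one_mul] using stub_mvCoeffMulBound (ψ ^ k) ψ 1 1 zero_le_one zero_le_one ih hψ n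

open MvPowerSeries in
/-- **Stub `stub_katzDataPolynomial` (the `d`-free algebra of Katz data).**
`K` a nonarchimedean normed field, `σ` any set of variables, `V : ℤ → Set (MvPowerSeries σ K)` a graded
family of `K`-subspaces closed under products (`V b₁ · V b₂ ⊆ V (b₁+b₂)`, `1 ∈ V 0`), `e` an integral
series with constant term `1` (a Hasse lift of weight `t`), `(a_i)` a Katz datum of weight `w`
(`a_i ∈ V (w + i t)`, `‖a_i‖ ≤ C ρ^i`, `0 ≤ ρ ≤ 1 ≤ C`) with Katz sum `G = Σ a_i e^{-i}`
(coefficientwise `HasSum`).  Then for finitely many `u`: exponents `j_u ≤ D`, integral series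
`f_u ∈ V (T - j_u w)` and scalars `‖λ_u‖ ≤ 1`, the polynomial expression `F = Σ_u λ_u f_u G^{j_u}` is
again a Katz sum of weight `T`: it has a datum `A_i ∈ V (T + i t)` with `‖A_i‖ ≤ C^D ρ^i` summing to
`F` along `e⁻¹`, and `‖F_n‖ ≤ C^D` for all `n`.  The datum is
`A_i = Σ_u λ_u f_u · coeff_i (Φ ^ {j_u})` for the generating series `Φ = Σ_i a_i X^i`. [folklore] -/
theorem stub_katzDataPolynomial {K σ U : Type*} [NormedField K] [IsUltrametricDist K] [Fintype U]
    (V : ℤ → Set (MvPowerSeries σ K)) (hV1 : (1 : MvPowerSeries σ K) ∈ V 0)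
    (hV0 : ∀ b : ℤ, (0 : MvPowerSeries σ K) ∈ V b)
    (hVadd : ∀ (b : ℤ) (φ ψ : MvPowerSeries σ K), φ ∈ V b → ψ ∈ V b → φ + ψ ∈ V b)
    (hVsmul : ∀ (b : ℤ) (c : K) (φ : MvPowerSeries σ K), φ ∈ V b → c • φ ∈ V b)
    (hVmul : ∀ (b₁ b₂ : ℤ) (φ ψ : MvPowerSeries σ K), φ ∈ V b₁ → ψ ∈ V b₂ → φ * ψ ∈ V (b₁ + b₂))
    (e : MvPowerSeries σ K) (t : ℤ) (he0 : constantCoeff e = 1) (he : ∀ n, ‖coeff n e‖ ≤ 1)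
    (a : ℕ → MvPowerSeries σ K) (w : ℤ) (haV : ∀ i : ℕ, a i ∈ V (w + i * t))
    (ρ C : ℝ) (hρ : 0 ≤ ρ) (hρ1 : ρ ≤ 1) (hC : 1 ≤ C) (ha : ∀ i n, ‖coeff n (a i)‖ ≤ C * ρ ^ i)
    (G : MvPowerSeries σ K) (hG : ∀ n, HasSum (fun i : ℕ ↦ coeff n (a i * e⁻¹ ^ i)) (coeff n G))
    (D : ℕ) (j : U → ℕ) (hj : ∀ u, j u ≤ D) (T : ℤ)
    (f : U → MvPowerSeries σ K) (hfV : ∀ u, f u ∈ V (T - j u * w))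
    (hf : ∀ u n, ‖coeff n (f u)‖ ≤ 1) (l : U → K) (hl : ∀ u, ‖l u‖ ≤ 1) :
    ∃ A : ℕ → MvPowerSeries σ K,
      (∀ i : ℕ, A i ∈ V (T + i * t)) ∧ (∀ i n, ‖coeff n (A i)‖ ≤ C ^ D * ρ ^ i) ∧
      (∀ n, HasSum (fun i : ℕ ↦ coeff n (A i * e⁻¹ ^ i)) (coeff n (∑ u, l u • (f u * G ^ j u)))) ∧
      ∀ n, ‖coeff n (∑ u, l u • (f u * G ^ j u))‖ ≤ C ^ D := by
  classical
  have hC0 : (0 : ℝ) ≤ C := zero_le_one.trans hC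
  have hCD0 : (0 : ℝ) ≤ C ^ D := pow_nonneg hC0 D
  -- the generating series `Φ = Σ_i a_i X^i` of the datum
  obtain ⟨Φ, hΦ⟩ : ∃ Φ : PowerSeries (MvPowerSeries σ K), ∀ i, PowerSeries.coeff i Φ = a i :=
    ⟨PowerSeries.mk a, fun i ↦ PowerSeries.coeff_mk i a⟩
  have hΦmem : ∀ i : ℕ, PowerSeries.coeff i Φ ∈ V (w + i * t) := fun i ↦ by
    rw [hΦ]
    exact haV i
  have hΦnorm : ∀ i n, ‖MvPowerSeries.coeff n (PowerSeries.coeff i Φ)‖ ≤ C * ρ ^ i := fun i n ↦ by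
    rw [hΦ]
    exact ha i n
  have hΦsum : ∀ n, HasSum (fun i : ℕ ↦ MvPowerSeries.coeff n (PowerSeries.coeff i Φ * e⁻¹ ^ i))
      (MvPowerSeries.coeff n G) := fun n ↦ by
    simpa only [hΦ] using hG n
  -- its powers `Φ ^ m`: Katz data of weight `m w` summing to `G ^ m`
  have hPmem := katzPoly_memFamily_pow V hV1 hV0 hVadd hVmul t w Φ hΦmem
  have hPnorm := katzPoly_normFamily_pow ρ C hρ hC0 Φ hΦnorm
  have hPsum := katzPoly_sumFamily_pow e⁻¹ Φ G hΦsum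
  -- integrality of the powers of `e⁻¹`
  have hEinv : ∀ (k : ℕ) n, ‖MvPowerSeries.coeff n (e⁻¹ ^ k)‖ ≤ 1 :=
    katzPoly_normCoeff_pow_le_one e⁻¹ (stub_mvCoeffInvBound e he0 he)
  -- the pieces `f_u · coeff_i (Φ ^ j_u)`: weight `T`, norm `≤ C^D ρ^i`, summing to `f_u G^{j_u}`
  have hBmem : ∀ (u : U) (i : ℕ), f u * PowerSeries.coeff i (Φ ^ j u) ∈ V (T + i * t) := by
    intro u i
    have hidx : T + (i : ℤ) * t = (T - j u * w) + (j u * w + i * t) := by ring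
    rw [hidx]
    exact hVmul _ _ _ _ (hfV u) (hPmem (j u) i)
  have hBnorm : ∀ (u : U) (i : ℕ) n,
      ‖MvPowerSeries.coeff n (f u * PowerSeries.coeff i (Φ ^ j u))‖ ≤ C ^ D * ρ ^ i := by
    intro u i n
    calc ‖MvPowerSeries.coeff n (f u * PowerSeries.coeff i (Φ ^ j u))‖ ≤ 1 * (C ^ j u * ρ ^ i) :=
          stub_mvCoeffMulBound (f u) _ 1 (C ^ j u * ρ ^ i) zero_le_one
            (mul_nonneg (pow_nonneg hC0 _) (pow_nonneg hρ i)) (hf u) (hPnorm (j u) i) n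
      _ ≤ C ^ D * ρ ^ i := by
          rw [one_mul]
          exact mul_le_mul_of_nonneg_right (pow_le_pow_right₀ hC (hj u)) (pow_nonneg hρ i)
  have hBsum : ∀ (u : U) n, HasSum
      (fun i : ℕ ↦ MvPowerSeries.coeff n (f u * PowerSeries.coeff i (Φ ^ j u) * e⁻¹ ^ i))
      (MvPowerSeries.coeff n (f u * G ^ j u)) := by
    intro u n
    rw [MvPowerSeries.coeff_mul]
    have h := hasSum_sum fun (p : (σ →₀ ℕ) × (σ →₀ ℕ))
        (_ : p ∈ Finset.HasAntidiagonal.antidiagonal n) ↦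
      (hPsum (j u) p.2).mul_left (MvPowerSeries.coeff p.1 (f u))
    refine h.congr_fun fun i ↦ ?_
    rw [mul_assoc, MvPowerSeries.coeff_mul]
  -- the datum `A_i = Σ_u λ_u f_u · coeff_i (Φ ^ j_u)`
  have hAnorm : ∀ (i : ℕ) n,
      ‖MvPowerSeries.coeff n (∑ u, l u • (f u * PowerSeries.coeff i (Φ ^ j u)))‖ ≤ C ^ D * ρ ^ i := by
    intro i n
    rw [map_sum]
    refine IsUltrametricDist.norm_sum_le_of_forall_le_of_nonneg
      (mul_nonneg hCD0 (pow_nonneg hρ i)) fun u _ ↦ ?_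
    rw [MvPowerSeries.coeff_smul, norm_mul]
    calc ‖l u‖ * ‖MvPowerSeries.coeff n (f u * PowerSeries.coeff i (Φ ^ j u))‖
        ≤ 1 * (C ^ D * ρ ^ i) := mul_le_mul (hl u) (hBnorm u i n) (norm_nonneg _) zero_le_one
      _ = C ^ D * ρ ^ i := one_mul _
  have hAsum : ∀ n, HasSum
      (fun i : ℕ ↦ MvPowerSeries.coeff n
        ((∑ u, l u • (f u * PowerSeries.coeff i (Φ ^ j u))) * e⁻¹ ^ i))
      (MvPowerSeries.coeff n (∑ u, l u • (f u * G ^ j u))) := by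
    intro n
    have h := hasSum_sum fun (u : U) (_ : u ∈ Finset.univ) ↦ (hBsum u n).mul_left (l u)
    rw [map_sum]
    simp_rw [MvPowerSeries.coeff_smul]
    refine h.congr_fun fun i ↦ ?_
    simp only [Finset.sum_mul, map_sum, smul_mul_assoc, MvPowerSeries.coeff_smul]
  refine ⟨fun i ↦ ∑ u, l u • (f u * PowerSeries.coeff i (Φ ^ j u)), fun i ↦ ?_, hAnorm, hAsum,
    fun n ↦ ?_⟩
  · -- membership `A_i ∈ V (T + i t)`
    exact Finset.sum_induction _ (fun φ ↦ φ ∈ V (T + i * t))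
      (fun φ ψ hφ hψ ↦ hVadd _ φ ψ hφ hψ) (hV0 _) fun u _ ↦ hVsmul _ (l u) _ (hBmem u i)
  · -- the sup-norm bound `‖F_n‖ ≤ C^D`: ultrametric `tsum` inequality
    rw [← (hAsum n).tsum_eq]
    refine IsUltrametricDist.norm_tsum_le_of_forall_le_of_nonneg hCD0 fun i ↦ ?_
    calc ‖MvPowerSeries.coeff n
          ((∑ u, l u • (f u * PowerSeries.coeff i (Φ ^ j u))) * e⁻¹ ^ i)‖ ≤ C ^ D * ρ ^ i * 1 :=
          stub_mvCoeffMulBound _ _ (C ^ D * ρ ^ i) 1 (mul_nonneg hCD0 (pow_nonneg hρ i))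
            zero_le_one (hAnorm i) (hEinv i) n
      _ ≤ C ^ D := by
          rw [mul_one]
          exact mul_le_of_le_one_right hCD0 (pow_le_one₀ hρ hρ1)

end Summit.Langlands.Langlands.Theorems.HilbertIntegralOverconvergentIsCongruence

end
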